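import Mathlib
import Literature.Probability.RandomPlanarGeometry.PlaneNonIntersection
import HarnessLib

/-!
# The `5/8` non-intersection estimate ⇐ Lawler's up-to-constants estimate with SOME exponent and
# the value of the exponent (Lawler–Schramm–Werner) (fact split)

Topic `Literature/Probability/RandomPlanarGeometry`. Fact-decomposition file (librarian, mode
`fact-decompose`, 2026-08-16) for the named fact
`Literature.Probability.RandomPlanarGeometry.LSW2001_srw_nonIntersection_five_eighths`
(`PlaneNonIntersection.lean`): for two independent simple random walks on `ℤ²` from neighbouring
vertices, `c⁻¹ k^{-5/8} ≤ P[S[0,k] ∩ S'[0,k] = ∅] ≤ c k^{-5/8}` (`k ≥ 1`) — the display following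
Theorem 1 of G. F. Lawler, O. Schramm, W. Werner, *Values of Brownian intersection exponents II:
Plane exponents*, Acta Math. 187 (2001), which the authors obtain by COMBINING two results:

> "It was shown in [BL1] that the exponent `ζ₂` equals the corresponding exponent for simple
> random walks (see also [CM]). This result was sharpened in [Lwalkcut, LP], where estimates were
> derived up to multiplicative constants. It follows from these results and Theorem 1 that …"

namely (1) Lawler, *Cut times for simple random walk*, EJP 1 (1996), (3)/Thm. 1.3: the random
walk non-intersection probability is `≍ n^{-ζ}` UP TO CONSTANTS, `ζ = ζ₂` the (Brownian = random
walk, Burdzy–Lawler 1990) intersection exponent, whose value is not determined there; and (2)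
LSW's Theorem 1: `ζ₂ = 5/8`.  Neither is in the tree (no planar Brownian motion, no `SLE₆`), and
the seat's verdict was `xl-apex` on exactly these two.  This file NAMES them in the random-walk
vocabulary of the fact — so that no Brownian notion is needed to STATE them — and PROVES the
printed combination:

* `Lawler1996_srw_nonIntersection_upToConstants` — there are an exponent `ζ` and `c > 0` with
  `c⁻¹ k^{-ζ} ≤ p_k ≤ c k^{-ζ}` for all `k ≥ 1`, `p_k = #{non-intersecting pairs}/16^k`
  (Lawler 1996 (3) and Thm. 1.3, `d = 2`, transposed to neighbouring starting points as in LSW's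
  sentence; the exponent is existential: its existence as a limit is Burdzy–Lawler 1990).
* `LSW2001_srw_nonIntersectionExponent_eq` — the logarithmic asymptotics
  `log p_k / log k → −5/8` (LSW 2001 Thm. 1, `ζ₂ = 5/8`, read for random walks through
  Burdzy–Lawler's invariance principle [BL1]: the walk exponent equals the Brownian one).
* `LSW2001_srw_nonIntersection_five_eighths_holds_of` — PROVED (real analysis): the two-sided
  bound forces `log p_k / log k → −ζ`, uniqueness of limits gives `ζ = 5/8`, and the bound with
  this `ζ` is the fact.

Neither child restates the parent: the first has an unspecified exponent, the second is a
logarithmic (not up-to-constants) statement; only together do they give the parent.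

## References

* G. F. Lawler, O. Schramm, W. Werner, Acta Math. 187 (2001) 275–308 (arXiv:math/0003156):
  Thm. 1 and §1, display after Thm. 1. [LawlerSchrammWerner2001PlaneExponents]
* G. F. Lawler, *Cut times for simple random walk*, Electron. J. Probab. 1 (1996), paper 13:
  (2), (3), Thm. 1.3. [Lawler1996CutTimes]
* K. Burdzy, G. F. Lawler, *Non-intersection exponents for Brownian paths. I*, Probab. Theory
  Related Fields 84 (1990) 393–410. [BurdzyLawler1990NonIntersectionI]
-/

noncomputable section

open Filter Topology
open Literature.Probability.RandomPlanarGeometry.PlaneNonIntersection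

namespace Literature.Probability.RandomPlanarGeometry

/-- **Lawler 1996, (3) / Theorem 1.3 (`d = 2`), up to constants with an unspecified exponent.**
Printed (EJP 1:13, §1 (3)): "for `d = 2, 3`, there are constants `c₄, c₅` such that for all `n`,
`c₄ n^{-ζ} ≤ P{S¹[0,n] ∩ S²(0,n] = ∅} ≤ c₅ n^{-ζ}`", `ζ = ζ_d` the intersection exponent ((2):
"the logarithms of both sides are asymptotic"; existence of `ζ` and equality of the Brownian and
random-walk exponents: Burdzy–Lawler 1990), and Thm. 1.3 (the two-sided estimate at the Brownian
scale, from which (3) follows).  Vendored, as LSW apply it (§1: "started from neighboring vertices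
in `ℤ²`"), for the probability `p_k = nonIntersectingPairs k / 16^k` of the parent fact (two
`k`-step walks from `0` and `e₁` with disjoint ranges) and with the EXPONENT EXISTENTIAL: there
are `ζ` and `c > 0` with `c⁻¹ k^{-ζ} ≤ p_k ≤ c k^{-ζ}` for all `k ≥ 1`.  (Passing between the
origin-started event `S¹[0,n] ∩ S²(0,n] = ∅` and the neighbour-started one costs constant
factors: condition on the first step of `S²`.)  The value of `ζ` is
`LSW2001_srw_nonIntersectionExponent_eq`. [cite: Lawler1996CutTimes, §1 (3) and Theorem 1.3]
[cite: LawlerSchrammWerner2001PlaneExponents, §1 (display after Thm 1)] -/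
def Lawler1996_srw_nonIntersection_upToConstants : Prop :=
  ∃ ζ c : ℝ, 0 < c ∧ ∀ k : ℕ, 1 ≤ k →
    c⁻¹ * (k : ℝ) ^ (-ζ) ≤ (nonIntersectingPairs k : ℝ) / 16 ^ k ∧
      (nonIntersectingPairs k : ℝ) / 16 ^ k ≤ c * (k : ℝ) ^ (-ζ)

/-- **Lawler–Schramm–Werner 2001, Theorem 1 for `n = 2` (`ζ₂ = 5/8`), in random-walk form.**
Printed: Thm. 1, "`ζ_n = (4n² − 1)/24` for all `n ≥ 2`" for the planar Brownian intersection
exponents, and §1: "It was shown in [BL1] that the exponent `ζ₂` equals the corresponding exponent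
for simple random walks".  Rendered without Brownian motion as the logarithmic asymptotics of the
parent fact's probability: `log p_k / log k → −5/8` as `k → ∞`,
`p_k = nonIntersectingPairs k / 16^k` (two independent `k`-step simple random walks on `ℤ²` from
neighbouring vertices have disjoint ranges with probability `k^{-5/8 + o(1)}`).  The proof in
print is `SLE₆` (LSW I–II) for the Brownian value and Burdzy–Lawler's strong approximation for
the transfer to walks. [cite: LawlerSchrammWerner2001PlaneExponents, Thm 1 (n = 2) and §1]
[cite: BurdzyLawler1990NonIntersectionI, Thm. 1.1–1.2 (existence and invariance of the exponent)] -/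
def LSW2001_srw_nonIntersectionExponent_eq : Prop :=
  Tendsto (fun k : ℕ => Real.log ((nonIntersectingPairs k : ℝ) / 16 ^ k) / Real.log (k : ℝ))
    atTop (𝓝 (-(5 / 8 : ℝ)))

/-- **Assembly (fact split): the `5/8` estimate up to constants from Lawler's estimate and the
value of the exponent** ("It follows from these results and Theorem 1 that …", LSW §1).  From
`c⁻¹ k^{-ζ} ≤ p_k ≤ c k^{-ζ}`: `|log p_k + ζ log k| ≤ |log c|`, so `log p_k / log k → −ζ`;
limits are unique, so `ζ = 5/8`, and Lawler's bound is the claim.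
[cite: LawlerSchrammWerner2001PlaneExponents, §1 (display after Thm 1)] -/
theorem LSW2001_srw_nonIntersection_five_eighths_holds_of
    (h1 : Lawler1996_srw_nonIntersection_upToConstants)
    (h2 : LSW2001_srw_nonIntersectionExponent_eq) :
    LSW2001_srw_nonIntersection_five_eighths := by
  obtain ⟨ζ, c, hc, hk⟩ := h1
  set p : ℕ → ℝ := fun k => (nonIntersectingPairs k : ℝ) / 16 ^ k with hp
  -- positivity of `p k` for `k ≥ 1`
  have hpos : ∀ k : ℕ, 1 ≤ k → 0 < p k := by
    intro k hk1
    have hk0 : (0 : ℝ) < k := by exact_mod_cast hk1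
    exact lt_of_lt_of_le (mul_pos (inv_pos.2 hc) (Real.rpow_pos_of_pos hk0 _)) (hk k hk1).1
  -- the key inequality `|log (p k) + ζ log k| ≤ |log c|` for `k ≥ 1`
  have hkey : ∀ k : ℕ, 1 ≤ k → |Real.log (p k) + ζ * Real.log (k : ℝ)| ≤ |Real.log c| := by
    intro k hk1
    have hk0 : (0 : ℝ) < k := by exact_mod_cast hk1
    have hrpow : 0 < (k : ℝ) ^ (-ζ) := Real.rpow_pos_of_pos hk0 _
    obtain ⟨hlo, hhi⟩ := hk k hk1
    have hup : Real.log (p k) ≤ Real.log c + -(ζ * Real.log (k : ℝ)) := by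
      have := Real.log_le_log (hpos k hk1) hhi
      rwa [Real.log_mul hc.ne' hrpow.ne', Real.log_rpow hk0, neg_mul] at this
    have hdown : -Real.log c + -(ζ * Real.log (k : ℝ)) ≤ Real.log (p k) := by
      have := Real.log_le_log (mul_pos (inv_pos.2 hc) hrpow) hlo
      rwa [Real.log_mul (inv_ne_zero hc.ne') hrpow.ne', Real.log_rpow hk0, Real.log_inv, neg_mul] at this
    rw [abs_le]
    constructor
    · linarith [neg_abs_le (Real.log c), le_abs_self (Real.log c)]
    · linarith [neg_abs_le (Real.log c), le_abs_self (Real.log c)]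
  -- hence `log (p k) / log k → -ζ`
  have hlog : Tendsto (fun k : ℕ => |Real.log c| / Real.log (k : ℝ)) atTop (𝓝 0) :=
    tendsto_const_nhds.div_atTop (Real.tendsto_log_atTop.comp tendsto_natCast_atTop_atTop)
  have hlim : Tendsto (fun k : ℕ => Real.log (p k) / Real.log (k : ℝ)) atTop (𝓝 (-ζ)) := by
    rw [tendsto_iff_dist_tendsto_zero]
    refine squeeze_zero' (Eventually.of_forall fun k => dist_nonneg) ?_ hlog
    filter_upwards [eventually_ge_atTop 2] with k hk2
    have hk1 : 1 ≤ k := le_trans (by norm_num) hk2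
    have hL : 0 < Real.log (k : ℝ) := Real.log_pos (by exact_mod_cast hk2)
    rw [Real.dist_eq]
    have hrew : Real.log (p k) / Real.log (k : ℝ) - -ζ =
        (Real.log (p k) + ζ * Real.log (k : ℝ)) / Real.log (k : ℝ) := by
      field_simp
      ring
    rw [hrew, abs_div, abs_of_pos hL]
    exact div_le_div_of_nonneg_right (hkey k hk1) hL.le
  -- uniqueness of limits: `ζ = 5/8`
  have hζ : ζ = 5 / 8 := by
    have h := tendsto_nhds_unique hlim h2
    linarith
  subst hζ
  exact ⟨c, hc, hk⟩

end Literature.Probability.RandomPlanarGeometry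

end
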